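import Mathlib
import Summits.ValiantsHypothesis.ValiantsHypothesis.Theorems.NewtonUnitEquationsNewtonTauWeakCornerDefs

/-!
# `NewtonTauWeak` (stmt-ValiantsHypothesis-5904), stub `fixedKCoincidence_t2_K3`: the FLIP IDENTITY

Support file (siege k16).  The global-to-local identity of `Cruxes/NewtonTauWeak/Lines/binomial-normal-form-ltc.md`
§2 as an honest identity in the Laurent ring `ℂ[ℤ²]`: given a line structure of the exponent list
(`d_j = mult_j · ep_{cls j}` for `d_j ≠ 0`) and ANY set `S` of lines declared positive, the image of
`f = Σ_{l<3} c_l Π_j (1 - ρ_{lj} X^{d_j})` under a ring map `φ : ℂ[X,Y] → ℂ[ℤ²]` sending monomials to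
monomials is `X^{p⋆(S)} · Σ_l κ_l Π_i P̃_{l,i}(X^{E_i})`, where `E_i = ±ep_i` (sign by `S`), `P_{l,i}` is the
product of the univariate binomials of line `i`, `P̃ = P` on positive lines and `P̃ = s^{M_i - deg P} · rev(P)` on
flipped lines (`k16_flip`).  Ingredients: grouping the factors by lines, `X^{d_j} = (X^{ep_i})^{mult_j}`, and the
reversal identity `P(X^{z}) = X^{deg P · z} · rev(P)(X^{-z})` (`rayEval_flip`, from
`Polynomial.eval₂_reverse_mul_pow`).  Degree bound `deg P̃ ≤ M_i` (`natDegree_flipFactor_le`). [folklore]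
-/

set_option linter.dupNamespace false

noncomputable section

open scoped BigOperators Polynomial

namespace Summit.ValiantsHypothesis.ValiantsHypothesis.Theorems.NewtonTauWeakFixedK3k16

/-! ## Reversal on a ray -/

/-- **Reversal identity** `P(X^{z}) = X^{deg P · z} · rev(P)(X^{-z})` in the Laurent ring. [folklore] -/
theorem rayEval_flip (P : ℂ[X]) (z : Fin 2 → ℤ) :
    Polynomial.aeval (AddMonoidAlgebra.single z (1 : ℂ)) P =
      AddMonoidAlgebra.single ((P.natDegree : ℤ) • z) (1 : ℂ) *
        Polynomial.aeval (AddMonoidAlgebra.single (-z) (1 : ℂ)) P.reverse := by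
  letI : Invertible (AddMonoidAlgebra.single z (1 : ℂ)) :=
    ⟨AddMonoidAlgebra.single (-z) 1,
      by rw [AddMonoidAlgebra.single_mul_single, neg_add_cancel, mul_one, AddMonoidAlgebra.one_def],
      by rw [AddMonoidAlgebra.single_mul_single, add_neg_cancel, mul_one, AddMonoidAlgebra.one_def]⟩
  have h := Polynomial.eval₂_reverse_mul_pow (algebraMap ℂ (AddMonoidAlgebra ℂ (Fin 2 → ℤ)))
    (AddMonoidAlgebra.single z (1 : ℂ)) P
  rw [Polynomial.aeval_def, Polynomial.aeval_def, ← h]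
  change Polynomial.eval₂ _ (AddMonoidAlgebra.single (-z) (1 : ℂ)) P.reverse * _ = _
  rw [AddMonoidAlgebra.single_pow, one_pow, natCast_zsmul, mul_comm]

/-- Degree of a binomial factor `1 - ρ s^m`. [folklore] -/
theorem natDegree_binomialFactor_le (ρ : ℂ) (m : ℕ) :
    (1 - Polynomial.C ρ * Polynomial.X ^ m : ℂ[X]).natDegree ≤ m := by
  refine (Polynomial.natDegree_sub_le _ _).trans (max_le (by simp) ?_)
  exact (Polynomial.natDegree_C_mul_le _ _).trans (by simp)

/-- Degree of a line factor is at most the multiplicity of the line. [folklore] -/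
theorem natDegree_lineFactor_le {ι : Type*} (t : Finset ι) (ρ : ι → ℂ) (mult : ι → ℕ) :
    (∏ j ∈ t, (1 - Polynomial.C (ρ j) * Polynomial.X ^ mult j : ℂ[X])).natDegree ≤ ∑ j ∈ t, mult j :=
  (Polynomial.natDegree_prod_le _ _).trans (Finset.sum_le_sum fun j _ => natDegree_binomialFactor_le (ρ j) (mult j))

/-- Degree of the flipped factor `s^{M - deg P} · rev(P)` is at most `M` when `deg P ≤ M`. [folklore] -/
theorem natDegree_flipFactor_le (P : ℂ[X]) {Mi : ℕ} (hP : P.natDegree ≤ Mi) :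
    (Polynomial.X ^ (Mi - P.natDegree) * P.reverse).natDegree ≤ Mi := by
  refine (Polynomial.natDegree_mul_le).trans ?_
  rw [Polynomial.natDegree_X_pow]
  have := Polynomial.reverse_natDegree_le P
  omega

/-- Constant coefficient of a line factor. [folklore] -/
theorem coeff_zero_lineFactor {ι : Type*} (t : Finset ι) (ρ : ι → ℂ) (mult : ι → ℕ) (hm : ∀ j ∈ t, 1 ≤ mult j) :
    (∏ j ∈ t, (1 - Polynomial.C (ρ j) * Polynomial.X ^ mult j : ℂ[X])).coeff 0 = 1 := by
  classical
  induction t using Finset.induction_on with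
  | empty => simp
  | insert a t ha ih =>
    rw [Finset.prod_insert ha, Polynomial.mul_coeff_zero, ih fun j hj => hm j (Finset.mem_insert_of_mem hj)]
    have h1 : 1 ≤ mult a := hm a (Finset.mem_insert_self a t)
    simp [Polynomial.coeff_X_pow, show (0 : ℕ) ≠ mult a by omega]

/-! ## The flip identity -/

/-- One binomial factor on line `i`: `φ(1 - ρ X^{d_j}) = (1 - ρ s^{mult j})(X^{ep_i})`. [folklore] -/
theorem flip_factor (φ : MvPolynomial (Fin 2) ℂ →+* AddMonoidAlgebra ℂ (Fin 2 → ℤ))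
    (hφC : ∀ a : ℂ, φ (MvPolynomial.C a) = a • 1)
    (hφm : ∀ m : Fin 2 →₀ ℕ, φ (MvPolynomial.monomial m 1) = AddMonoidAlgebra.single (fun k => (m k : ℤ)) 1)
    (dj : Fin 2 →₀ ℕ) (epi : Fin 2 → ℤ) (mj : ℕ) (hd : ∀ k, ((dj k : ℕ) : ℤ) = (mj : ℤ) * epi k) (ρ : ℂ) :
    φ (1 - MvPolynomial.C ρ * MvPolynomial.monomial dj 1) =
      Polynomial.aeval (AddMonoidAlgebra.single epi (1 : ℂ)) (1 - Polynomial.C ρ * Polynomial.X ^ mj) := by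
  have hdj : (fun k => ((dj k : ℕ) : ℤ)) = mj • epi := by
    funext k; rw [hd k]; simp
  rw [map_sub, map_one, map_mul, hφC, hφm, map_sub, map_one, map_mul, Polynomial.aeval_C, map_pow,
    Polynomial.aeval_X, AddMonoidAlgebra.single_pow, one_pow, hdj, Algebra.smul_def, mul_one]

/-- **FLIP IDENTITY** (siege k16; see the file header). [folklore] -/
theorem k16_flip {N s : ℕ} (d : Fin N → Fin 2 →₀ ℕ) (ep : Fin s → Fin 2 → ℤ) (cls : Fin N → Fin s)
    (mult : Fin N → ℕ) (hd : ∀ j, d j ≠ 0 → 1 ≤ mult j ∧ ∀ k, ((d j k : ℕ) : ℤ) = (mult j : ℤ) * ep (cls j) k)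
    (φ : MvPolynomial (Fin 2) ℂ →+* AddMonoidAlgebra ℂ (Fin 2 → ℤ))
    (hφC : ∀ a : ℂ, φ (MvPolynomial.C a) = a • 1)
    (hφm : ∀ m : Fin 2 →₀ ℕ, φ (MvPolynomial.monomial m 1) = AddMonoidAlgebra.single (fun k => (m k : ℤ)) 1)
    (c : Fin 3 → ℂ) (ρ : Fin 3 → Fin N → ℂ) (S : Finset (Fin s)) :
    φ (∑ l, MvPolynomial.C (c l) * ∏ j, (1 - MvPolynomial.C (ρ l j) * MvPolynomial.monomial (d j) 1)) =
      AddMonoidAlgebra.single (∑ i ∈ Finset.univ.filter (fun i => i ∉ S),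
          ((∑ j ∈ Finset.univ.filter (fun j => d j ≠ 0 ∧ cls j = i), mult j : ℕ) : ℤ) • ep i) (1 : ℂ) *
      ∑ l, (c l * ∏ j ∈ Finset.univ.filter (fun j => d j = 0), (1 - ρ l j)) •
        ∏ i, Polynomial.aeval (AddMonoidAlgebra.single (if i ∈ S then ep i else -ep i) (1 : ℂ))
          (if i ∈ S then (∏ j ∈ Finset.univ.filter (fun j => d j ≠ 0 ∧ cls j = i),
              (1 - Polynomial.C (ρ l j) * Polynomial.X ^ mult j))
           else Polynomial.X ^ ((∑ j ∈ Finset.univ.filter (fun j => d j ≠ 0 ∧ cls j = i), mult j) -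
              (∏ j ∈ Finset.univ.filter (fun j => d j ≠ 0 ∧ cls j = i),
                (1 - Polynomial.C (ρ l j) * Polynomial.X ^ mult j)).natDegree) *
              (∏ j ∈ Finset.univ.filter (fun j => d j ≠ 0 ∧ cls j = i),
                (1 - Polynomial.C (ρ l j) * Polynomial.X ^ mult j)).reverse) := by
  classical
  -- abbreviations
  set Cl : Fin s → Finset (Fin N) := fun i => Finset.univ.filter (fun j => d j ≠ 0 ∧ cls j = i) with hCl
  set Mi : Fin s → ℕ := fun i => ∑ j ∈ Cl i, mult j with hMi
  set P : Fin 3 → Fin s → ℂ[X] := fun l i => ∏ j ∈ Cl i, (1 - Polynomial.C (ρ l j) * Polynomial.X ^ mult j) with hP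
  set E : Fin s → Fin 2 → ℤ := fun i => if i ∈ S then ep i else -ep i with hE
  set Pt : Fin 3 → Fin s → ℂ[X] := fun l i =>
    if i ∈ S then P l i else Polynomial.X ^ (Mi i - (P l i).natDegree) * (P l i).reverse with hPt
  set κ : Fin 3 → ℂ := fun l => c l * ∏ j ∈ Finset.univ.filter (fun j => d j = 0), (1 - ρ l j) with hκ
  set pstar : Fin 2 → ℤ := ∑ i ∈ Finset.univ.filter (fun i => i ∉ S), ((Mi i : ℕ) : ℤ) • ep i with hpstar
  change φ _ = AddMonoidAlgebra.single pstar (1 : ℂ) *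
    ∑ l, κ l • ∏ i, Polynomial.aeval (AddMonoidAlgebra.single (E i) (1 : ℂ)) (Pt l i)
  -- degree bound on the line factors
  have hPdeg : ∀ l i, (P l i).natDegree ≤ Mi i := fun l i => natDegree_lineFactor_le _ _ _
  -- constant factors `d j = 0`
  have hzero : ∀ l, ∏ j ∈ Finset.univ.filter (fun j => d j = 0),
      φ (1 - MvPolynomial.C (ρ l j) * MvPolynomial.monomial (d j) 1) =
        (∏ j ∈ Finset.univ.filter (fun j => d j = 0), (1 - ρ l j)) • (1 : AddMonoidAlgebra ℂ (Fin 2 → ℤ)) := by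
    intro l
    rw [Algebra.smul_def, mul_one, map_prod]
    refine Finset.prod_congr rfl fun j hj => ?_
    have hj0 : d j = 0 := (Finset.mem_filter.mp hj).2
    rw [map_sub, map_one, map_mul, hφC, hφm, hj0, map_sub, map_one, Algebra.algebraMap_eq_smul_one]
    have : (fun k : Fin 2 => (((0 : Fin 2 →₀ ℕ) k : ℕ) : ℤ)) = 0 := by funext k; simp
    rw [this, ← AddMonoidAlgebra.one_def, mul_one]
  -- one line
  have hline : ∀ l i, ∏ j ∈ Cl i, φ (1 - MvPolynomial.C (ρ l j) * MvPolynomial.monomial (d j) 1) =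
      Polynomial.aeval (AddMonoidAlgebra.single (ep i) (1 : ℂ)) (P l i) := by
    intro l i
    rw [hP]; dsimp only
    rw [map_prod]
    refine Finset.prod_congr rfl fun j hj => ?_
    obtain ⟨hj0, hji⟩ := (Finset.mem_filter.mp hj).2
    rw [← hji]
    exact flip_factor φ hφC hφm (d j) (ep (cls j)) (mult j) (hd j hj0).2 (ρ l j)
  -- flipping one line
  have hflip : ∀ l i, Polynomial.aeval (AddMonoidAlgebra.single (ep i) (1 : ℂ)) (P l i) =
      (if i ∈ S then 1 else AddMonoidAlgebra.single (((Mi i : ℕ) : ℤ) • ep i) (1 : ℂ)) *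
        Polynomial.aeval (AddMonoidAlgebra.single (E i) (1 : ℂ)) (Pt l i) := by
    intro l i
    by_cases hi : i ∈ S
    · simp only [hE, hPt, if_pos hi, one_mul]
    · simp only [hE, hPt, if_neg hi]
      rw [rayEval_flip (P l i) (ep i), map_mul, map_pow, Polynomial.aeval_X, AddMonoidAlgebra.single_pow, one_pow,
        ← mul_assoc, AddMonoidAlgebra.single_mul_single, mul_one]
      congr 2
      have hD := hPdeg l i
      rw [← natCast_zsmul, Nat.cast_sub hD, smul_neg, sub_smul]
      abel
  -- one product
  have hprod : ∀ l, φ (∏ j, (1 - MvPolynomial.C (ρ l j) * MvPolynomial.monomial (d j) 1)) =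
      (∏ j ∈ Finset.univ.filter (fun j => d j = 0), (1 - ρ l j)) •
        (AddMonoidAlgebra.single pstar (1 : ℂ) *
          ∏ i, Polynomial.aeval (AddMonoidAlgebra.single (E i) (1 : ℂ)) (Pt l i)) := by
    intro l
    rw [map_prod, ← Finset.prod_filter_mul_prod_filter_not Finset.univ (fun j => d j = 0), hzero l,
      smul_mul_assoc, one_mul]
    congr 1
    -- group the nonzero exponents by lines
    rw [← Finset.prod_fiberwise_of_maps_to (g := cls) (t := Finset.univ) (fun j _ => Finset.mem_univ (cls j))]
    have hfib : ∀ i, (Finset.univ.filter fun j => ¬ d j = 0).filter (fun j => cls j = i) = Cl i := by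
      intro i; rw [hCl, Finset.filter_filter]
    simp_rw [hfib, hline, hflip, Finset.prod_mul_distrib]
    congr 1
    rw [Finset.prod_ite, Finset.prod_const_one, one_mul, AddMonoidAlgebra.prod_single, Finset.prod_const_one]
  -- assemble
  rw [map_sum, Finset.mul_sum]
  refine Finset.sum_congr rfl fun l _ => ?_
  rw [map_mul, hφC, hprod l, hκ, smul_mul_assoc, one_mul, smul_smul, mul_smul_comm]

end Summit.ValiantsHypothesis.ValiantsHypothesis.Theorems.NewtonTauWeakFixedK3k16

end
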